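import Summits.BirchSwinnertonDyer.BirchSwinnertonDyer.Theorems.KolyvaginRoadThreeMethod2LevelSystemsOfBipartite
import Summits.BirchSwinnertonDyer.BirchSwinnertonDyer.Theorems.KolyvaginRoadThreeMethod2ParityRank
import Literature.NumberTheory.EllipticCurves.HeegnerPointsKolyvaginClassesPointsProofs
import HarnessLib

/-!
# Route `KolyvaginRoadThree`, crux `ZhangSharpFrameAtThreeHL` (item stmt-BirchSwinnertonDyer-19574): stub S2-KS with `selmer_inf`
# DISCHARGED and stub S1 from the FIRST FLOOR of the same mod-3 bipartite datum (route-file-free part of the bipartite terminal state)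
# (cell `bsd-stepL`, seat `bsd-stepL-zhang3-w2` g0; `--supports stmt-BirchSwinnertonDyer-19574`, helper; companion of
# `KolyvaginRoadThreeMethod2LevelSystemsOfBipartite` (p682024); the crux-by-name assembly is `KolyvaginRoadThreeMethod2CruxOfBipartite`)

WHAT. The registered METHOD line v3.2 of crux 19574 (`Cruxes/ZhangSharpFrameAtThreeHL/Lines/method2.lean`, skeleton 2e396e49c718) has the
terminal kernel state «crux BY NAME ⟸ h₁ + hCT3 + S1 + S2-KS» (koly3b g10 `PTAt.zhangSharpFrameAtThreeHL_of_routeBinders_of_bottom_of_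
levelSystems'`, p584651: `h₁ = PublishedInputsKolyThree`, `hCT3 = ShimuraCasselsTateLevelInputs` are the route's own `closes` binders; S1 =
`stub_bottomRankOneAtThree`, S2-KS = `stub_levelKolyvaginSystemsAtThree`). The companion file re-expressed S2-KS at a frame as ONE mod-3
BIPARTITE DATUM on the good unipotent-admissible levels (even-level classes `κ₀` with `realisation` at `∅` and the local axioms, odd-level
values `λ`, the one-directional reciprocity halves (A⇐) ∕ (B⇒)) plus the rank-0 ANCHOR (γ) at odd good levels, rank lowering (A1) being the
LANDED stub A. THIS FILE adds the two route-file-free pieces of the loop (the assembly to the crux BY NAME, which must import the route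
file through koly3b's terminal certificate, is the separate module `KolyvaginRoadThreeMethod2CruxOfBipartite`):

* §1 `stub_levelKolyvaginSystemsAtThree_of_bipartite'` — the companion's frame theorem with the binder `selmer_inf` DISCHARGED: `K` is
  imaginary quadratic, every infinite place is complex, `H¹(ℂ, ·) = 0`, so EVERY class satisfies E's Kummer condition there (tree
  `mem_selmerLocalKer_infinitePlace_of_isImaginaryQuadratic`). Five local axioms remain (`sign`, `selmer_off`, `ordinary_on`, `transverse_on`,
  `relation`).
* §2 `kolyvaginClass_one_ne_zero_of_bipartiteFirstFloor` ∕ `stub_bottomRankOneAtThree_of_bipartite` — stub S1's conclusion at a frame with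
  `dim_𝔽₃ Sel₃(E/K) = 1` from the FIRST FLOOR of the same datum: `realisation` at `m = ∅` names a conductor-1 datum `d` with `κ₀(∅, ∅) = c_d(1)`;
  the companion's `baseCase_of_oddLevelAnchor` at the bottom level `∅` (good, even, of total canonical rank one by zhang3-p1's eigen-dictionary
  `finrank_selmer_eq_finrank_selQ_add`) gives `κ₀(∅, ∅) ≠ 0` from (A1) at `∅` (stub A), (A⇐) at `(∅, q, ∅)` and (γ) at the one-prime levels —
  W. Zhang's proof of Thm. 7.2 for `(N⁺, N⁻) = (N, 1)`, the abstract twin of koly g16's concrete `Method2BottomOfDefiniteFirstFloor` (which reads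
  the same three inputs over the tree's Brandt module). Complex conjugation `c ≠ 1` is produced inside (`exists_algEquiv_ne_one_mul_self_eq_one`).
KERNEL READING (with the companion): S1 ∪ S2-KS ⟸ ONE mod-3 bipartite datum on the good unipotent-admissible levels (even-level
classes with `realisation` and five local axioms, odd-level values, (A⇐) ∕ (B⇒)) + the rank-0 anchor (γ) at odd good levels — W. Zhang §3 +
Thm 4.3's halves + Thm 7.1 at `p = 3` (the card's bricks R2 ∕ R4 ∕ R6 ∕ R7); nothing else of the E-side remains.

HONEST FRAMING: theorems only; 0 definitions, 0 named facts, 0 `sorry`; CONDITIONAL — the bipartite datum, its laws and the anchor are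
HYPOTHESES (binders); closes nothing (T7): neither S1 nor S2-KS is proved by this. PARTITION: O2@3 (B10) × A1 × crux 19574 × stubs S1 ∕ S2-KS — proves-glue. BSD is not proved by any of this.

References: [cite: WZhang2014, §3, Thm. 4.3, Prop. 5.4, Thm. 7.1, Thm. 7.2 (proof pp. 232–233), §8.1, §9 proof of Thm. 9.1]
[cite: BertoliniDarmon2005, Thm. 4.1, Thm. 4.2] [cite: GrossLMS1991, §4 (4.4), Prop. 2.3].
-/

noncomputable section

open scoped Classical

namespace Summit.BirchSwinnertonDyer.Rank1Residual.X11b.Three.Koly.Method2Bipartite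

open WeierstrassCurve NumberField IsDedekindDomain
  Literature.NumberTheory.EllipticCurves Literature.NumberTheory.EllipticCurves.ModularForms
  Literature.NumberTheory.GaloisRepresentations Module

open Summit.BirchSwinnertonDyer.Rank1Residual.X11b.Three.Koly.Method2

/-! ## §1 S2-KS at a frame from the bipartite datum, `selmer_inf` discharged -/

/-- **Stub S2-KS's text from a bipartite datum — `selmer_inf` DISCHARGED.** As `stub_levelKolyvaginSystemsAtThree_of_bipartite` (companion
file) but WITHOUT the binder `selmer_inf`: `K` is imaginary quadratic, so every infinite place `w` of `K` is complex, `K_w ≃ ℂ` is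
algebraically closed, `H¹(K_w, ·) = 0` and every class of `H¹(K, E[3])` satisfies E's Kummer condition at `w`
(`mem_selmerLocalKer_infinitePlace_of_isImaginaryQuadratic`). The remaining bipartite binders: `realisation`; `sign` ∕ `selmer_off` ∕
`ordinary_on` ∕ `transverse_on` ∕ `relation` at even good non-empty levels; (A⇐); (B⇒); the anchor (γ). (A1) is the landed stub A.
[cite: WZhang2014, §3, Thm. 4.3, Thm. 7.1, Thm. 7.2, §8.1 property (1)] [cite: BertoliniDarmon2005, Thm. 4.1, Thm. 4.2] -/
theorem stub_levelKolyvaginSystemsAtThree_of_bipartite' :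
    ∀ (W : WeierstrassCurve ℚ) [W.IsElliptic] [W.IsGloballyMinimal] [NeZero (W.conductorNorm ℤ)] (K : Type)
      [Field K] [NumberField K] (Dt : ModularParametrizationData W (W.conductorNorm ℤ)) (β : ℤ) (ι : K →+* ℂ),
      Summit.BirchSwinnertonDyer.Rank1Residual.ClassX11b W 3 → W.HasMultiplicativeReductionAtPrime 3 →
      Rank1Residual.Surj W 3 → Rank1Residual.Ram W 3 → ¬ 3 ∣ W.tamagawaProduct → IsImaginaryQuadratic K →
      Odd (NumberField.discr K) → SatisfiesHeegnerHypothesis (W.conductorNorm ℤ) K →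
      (W.quadraticTwist (NumberField.discr K : ℚ)).entireLFunction 1 ≠ 0 → NumberField.discr K ≠ -3 →
      (4 * (W.conductorNorm ℤ : ℤ)) ∣ β ^ 2 - NumberField.discr K → ¬ (3 : ℤ) ∣ Dt.c →
      ∀ (c : K ≃ₐ[ℚ] K), c ≠ 1 → ∀ [Module (ZMod 3) (V3 W K)],
      ∀ (ε₀ : Finset {q // IsUAdmissiblePrime W K q} → Bool)
        (κ₀ : Finset {ℓ // Zhang2014.IsKolyvaginPrime (W.conductorNorm ℤ) W K 3 ℓ} →
          Finset {q // IsUAdmissiblePrime W K q} → V3 W K)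
        (lam : Finset {ℓ // Zhang2014.IsKolyvaginPrime (W.conductorNorm ℤ) W K 3 ℓ} →
          Finset {q // IsUAdmissiblePrime W K q} → ZMod 3),
      -- realisation at `∅`
      (∀ m : Finset {ℓ // Zhang2014.IsKolyvaginPrime (W.conductorNorm ℤ) W K 3 ℓ},
        ∃ d : KolyvaginHeegnerData Dt β ι (∏ ℓ ∈ m, (ℓ : ℕ)), κ₀ m ∅ = d.kolyvaginClass Nat.prime_three 1) →
      -- sign
      (∀ n, GoodLevel W K n → n.Nonempty → Even n.card →
        ∀ m : Finset {ℓ // Zhang2014.IsKolyvaginPrime (W.conductorNorm ℤ) W K 3 ℓ},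
        conjAct W c ((3 ^ 1 : ℕ) : ℤ) (κ₀ m n) = sgn (ε₀ n ^^ Nat.bodd m.card) • κ₀ m n) →
      -- selmer_off
      (∀ n, GoodLevel W K n → n.Nonempty → Even n.card →
        ∀ (m : Finset {ℓ // Zhang2014.IsKolyvaginPrime (W.conductorNorm ℤ) W K 3 ℓ}) (v : HeightOneSpectrum (𝓞 K)),
        (∀ ℓ ∈ m, ((ℓ : ℕ) : 𝓞 K) ∉ v.asIdeal) → (∀ q ∈ n, ((q : ℕ) : 𝓞 K) ∉ v.asIdeal) →
        κ₀ m n ∈ selmerLocalKer (W.baseChange K) (v.adicCompletion K) ((3 ^ 1 : ℕ) : ℤ)) →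
      -- ordinary_on
      (∀ n, GoodLevel W K n → n.Nonempty → Even n.card →
        ∀ m : Finset {ℓ // Zhang2014.IsKolyvaginPrime (W.conductorNorm ℤ) W K 3 ℓ}, ∀ q ∈ n,
        ∀ v : HeightOneSpectrum (𝓞 K), ((q : ℕ) : 𝓞 K) ∈ v.asIdeal →
        κ₀ m n ∈ (W.baseChange K).ordinaryLocalKer (v.adicCompletion K) ((3 ^ 1 : ℕ) : ℤ)) →
      -- transverse_on
      (∀ n, GoodLevel W K n → n.Nonempty → Even n.card →
        ∀ m : Finset {ℓ // Zhang2014.IsKolyvaginPrime (W.conductorNorm ℤ) W K 3 ℓ}, ∀ ℓ ∈ m,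
        ∀ v : HeightOneSpectrum (𝓞 K), ((ℓ : ℕ) : 𝓞 K) ∈ v.asIdeal → κ₀ m n ∈ transverseLocalKer W K ι ℓ v) →
      -- relation (8.1)
      (∀ n, GoodLevel W K n → n.Nonempty → Even n.card →
        ∀ (m : Finset {ℓ // Zhang2014.IsKolyvaginPrime (W.conductorNorm ℤ) W K 3 ℓ})
          (ℓ : {ℓ // Zhang2014.IsKolyvaginPrime (W.conductorNorm ℤ) W K 3 ℓ}), ℓ ∉ m → ∀ v : HeightOneSpectrum (𝓞 K),
        ((ℓ : ℕ) : 𝓞 K) ∈ v.asIdeal →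
        (κ₀ (insert ℓ m) n ∈ (W.baseChange K).torsionLocalKer (v.adicCompletion K) ((3 ^ 1 : ℕ) : ℤ) ↔
          κ₀ m n ∈ (W.baseChange K).torsionLocalKer (v.adicCompletion K) ((3 ^ 1 : ℕ) : ℤ))) →
      -- (A⇐)
      (∀ (n : Finset {q // IsUAdmissiblePrime W K q}) (q : {q // IsUAdmissiblePrime W K q}),
        GoodLevel W K (insert q n) → Even n.card → q ∉ n →
        ∀ m : Finset {ℓ // Zhang2014.IsKolyvaginPrime (W.conductorNorm ℤ) W K 3 ℓ},
        lam m (insert q n) ≠ 0 → ∃ v : HeightOneSpectrum (𝓞 K), ((q : ℕ) : 𝓞 K) ∈ v.asIdeal ∧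
          κ₀ m n ∉ (W.baseChange K).torsionLocalKer (v.adicCompletion K) ((3 ^ 1 : ℕ) : ℤ)) →
      -- (B⇒)
      (∀ (n : Finset {q // IsUAdmissiblePrime W K q}) (q : {q // IsUAdmissiblePrime W K q}),
        GoodLevel W K (insert q n) → Odd n.card → q ∉ n →
        ∀ (m : Finset {ℓ // Zhang2014.IsKolyvaginPrime (W.conductorNorm ℤ) W K 3 ℓ}) (v : HeightOneSpectrum (𝓞 K)),
        ((q : ℕ) : 𝓞 K) ∈ v.asIdeal →
        κ₀ m (insert q n) ∉ (W.baseChange K).torsionLocalKer (v.adicCompletion K) ((3 ^ 1 : ℕ) : ℤ) →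
        lam m n ≠ 0) →
      -- (γ)
      (∀ n : Finset {q // IsUAdmissiblePrime W K q}, GoodLevel W K n → Odd n.card →
        finrank (ZMod 3) (SelQ W K c n true) + finrank (ZMod 3) (SelQ W K c n false) = 0 → lam ∅ n ≠ 0) →
      Nonempty (LevelKolyvaginSystem W K Dt β ι c) := by
  intro W _ _ _ K _ _ Dt β ι hX hmult hsurj hram htam hK hodd hH hLt h3 hβ hc c hc1 _ ε₀ κ₀ lam realisation sign
    selmer_off ordinary_on transverse_on relation lawA lawB anchor
  exact stub_levelKolyvaginSystemsAtThree_of_bipartite W K Dt β ι hX hmult hsurj hram htam hK hodd hH hLt h3 hβ hc c hc1 ε₀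
    κ₀ lam realisation sign selmer_off
    (fun n _ _ _ m w ↦ mem_selmerLocalKer_infinitePlace_of_isImaginaryQuadratic hK _ w (κ₀ m n))
    ordinary_on transverse_on relation lawA lawB anchor

/-! ## §2 S1 at a frame from the first floor of the bipartite datum -/

section FirstFloor

variable (W : WeierstrassCurve ℚ) (K : Type) [Field K] [NumberField K]
  [W.IsElliptic] [W.IsGloballyMinimal] [NeZero (W.conductorNorm ℤ)]
  (Dt : ModularParametrizationData W (W.conductorNorm ℤ)) (β : ℤ) (ι : K →+* ℂ) (c : K ≃ₐ[ℚ] K)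
  [Module (ZMod 3) (V3 W K)]

/-- **THE FIRST FLOOR: `c(1) ≢ 0 (mod 3)` at `dim_𝔽₃ Sel₃(E/K) = 1` from the bottom of a bipartite datum** (W. Zhang's proof of Thm. 7.2
for `(N⁺, N⁻) = (N, 1)` at `p = 3`, abstract form). Let `K` be imaginary quadratic, `c` an involution of `K`, `dim_𝔽₃ Sel₃(E/K) = 1`. GIVEN:
bottom classes `κ₀(m, ∅)` with `realisation` (they ARE the frame's Kolyvagin classes mod 3), values `λ(m, n)`, (A1) at level `∅` on good
levels (stub A's shape), (A⇐) at even good levels, and the anchor (γ) at odd good levels — THEN some conductor-1 Kolyvagin–Heegner datum `d`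
of the frame has `d.kolyvaginClass ≠ 0`: `realisation` at `m = ∅` names `d` with `κ₀(∅, ∅) = c_d(1)`, and `baseCase_of_oddLevelAnchor` at the
good even level `∅`, whose total canonical rank is `1` by the eigen-dictionary `finrank_selmer_eq_finrank_selQ_add`, gives `κ₀(∅, ∅) ≠ 0`.
[cite: WZhang2014, Thm. 7.2 (proof pp. 232–233), Thm. 7.1, (4.8)] [cite: GrossLMS1991, §4 (4.4)] -/
theorem kolyvaginClass_one_ne_zero_of_bipartiteFirstFloor (hK : IsImaginaryQuadratic K) (hcc : c * c = 1)
    {κ₀ : Finset {ℓ // Zhang2014.IsKolyvaginPrime (W.conductorNorm ℤ) W K 3 ℓ} →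
      Finset {q // IsUAdmissiblePrime W K q} → V3 W K}
    {lam : Finset {ℓ // Zhang2014.IsKolyvaginPrime (W.conductorNorm ℤ) W K 3 ℓ} →
      Finset {q // IsUAdmissiblePrime W K q} → ZMod 3}
    (realisation : ∀ m : Finset {ℓ // Zhang2014.IsKolyvaginPrime (W.conductorNorm ℤ) W K 3 ℓ},
      ∃ d : KolyvaginHeegnerData Dt β ι (∏ ℓ ∈ m, (ℓ : ℕ)), κ₀ m ∅ = d.kolyvaginClass Nat.prime_three 1)
    (hA1 : ∀ (n : Finset {q // IsUAdmissiblePrime W K q}) (μ : Bool) (x : V3 W K),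
      GoodLevel W K n → x ∈ SelQ W K c n μ → x ≠ 0 →
      ∃ q : {q // IsUAdmissiblePrime W K q}, q ∉ n ∧ GoodLevel W K (insert q n) ∧
        x ∉ SelQ W K c (insert q n) μ ∧
        SelQ W K c (insert q n) μ ≤ SelQ W K c n μ ∧
        finrank (ZMod 3) (SelQ W K c (insert q n) μ) + 1 = finrank (ZMod 3) (SelQ W K c n μ) ∧
        SelQ W K c (insert q n) (!μ) = SelQ W K c n (!μ))
    (lawA : ∀ (n : Finset {q // IsUAdmissiblePrime W K q}) (q : {q // IsUAdmissiblePrime W K q}),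
      GoodLevel W K (insert q n) → Even n.card → q ∉ n →
      ∀ m : Finset {ℓ // Zhang2014.IsKolyvaginPrime (W.conductorNorm ℤ) W K 3 ℓ},
      lam m (insert q n) ≠ 0 → ∃ v : HeightOneSpectrum (𝓞 K), ((q : ℕ) : 𝓞 K) ∈ v.asIdeal ∧
        κ₀ m n ∉ (W.baseChange K).torsionLocalKer (v.adicCompletion K) ((3 ^ 1 : ℕ) : ℤ))
    (anchor : ∀ n : Finset {q // IsUAdmissiblePrime W K q}, GoodLevel W K n → Odd n.card →
      finrank (ZMod 3) (SelQ W K c n true) + finrank (ZMod 3) (SelQ W K c n false) = 0 → lam ∅ n ≠ 0)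
    (h1 : finrank (ZMod 3)
      (AddSubgroup.toZModSubmodule 3 (selmerGroup (W.baseChange K) ((3 ^ 1 : ℕ) : ℤ))) = 1) :
    ∃ d : KolyvaginHeegnerData Dt β ι 1, d.kolyvaginClass Nat.prime_three 1 ≠ 0 := by
  -- the bottom level `∅`: good, even, of total canonical rank one
  have h1' : finrank (ZMod 3) (SelQ W K c ∅ true) + finrank (ZMod 3) (SelQ W K c ∅ false) = 1 := by
    rw [← finrank_selmer_eq_finrank_selQ_add W K hK c hcc]; exact h1
  have hne : κ₀ ∅ ∅ ≠ 0 :=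
    baseCase_of_oddLevelAnchor W K c hA1 lawA anchor ∅ (goodLevel_empty W K) (by simp) h1'
  -- `realisation` at `m = ∅`: the bottom class IS `c_d(1)` for a conductor-1 datum `d`
  obtain ⟨d, hd⟩ := realisation ∅
  simp only [Finset.prod_empty] at d hd
  exact ⟨d, hd ▸ hne⟩

end FirstFloor

/-- **Stub S1's text from the first floor of a bipartite datum, (A1) DISCHARGED.** The registered hypotheses of
`stub_bottomRankOneAtThree` VERBATIM, then a complex conjugation `c ≠ 1`, the `ZMod 3`-structure, the bottom-relevant part of a mod-3
bipartite datum — classes `κ₀` with `realisation`, values `λ`, (A⇐) at even good levels, the anchor (γ) at odd good levels — give: at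
`dim_𝔽₃ Sel₃(E/K) = 1` some conductor-1 Kolyvagin–Heegner datum has non-zero Kolyvagin class mod 3. (A1) is the landed stub A
(`Method2StubA.stub_levelRaisingAtThree`, p489918); `c² = 1` by `algEquiv_mul_self_eq_one`. [cite: WZhang2014, Thm. 7.2 (proof), Thm. 7.1,
Prop. 5.4, (4.8)] -/
theorem stub_bottomRankOneAtThree_of_bipartite :
    ∀ (W : WeierstrassCurve ℚ) [W.IsElliptic] [W.IsGloballyMinimal] [NeZero (W.conductorNorm ℤ)] (K : Type)
      [Field K] [NumberField K] (Dt : ModularParametrizationData W (W.conductorNorm ℤ)) (β : ℤ) (ι : K →+* ℂ),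
      Summit.BirchSwinnertonDyer.Rank1Residual.ClassX11b W 3 → W.HasMultiplicativeReductionAtPrime 3 →
      Rank1Residual.Surj W 3 → Rank1Residual.Ram W 3 → ¬ 3 ∣ W.tamagawaProduct → IsImaginaryQuadratic K →
      Odd (NumberField.discr K) → SatisfiesHeegnerHypothesis (W.conductorNorm ℤ) K →
      (W.quadraticTwist (NumberField.discr K : ℚ)).entireLFunction 1 ≠ 0 → NumberField.discr K ≠ -3 →
      (4 * (W.conductorNorm ℤ : ℤ)) ∣ β ^ 2 - NumberField.discr K → ¬ (3 : ℤ) ∣ Dt.c →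
      ∀ (c : K ≃ₐ[ℚ] K), c ≠ 1 → ∀ [Module (ZMod 3) (V3 W K)],
      ∀ (κ₀ : Finset {ℓ // Zhang2014.IsKolyvaginPrime (W.conductorNorm ℤ) W K 3 ℓ} →
          Finset {q // IsUAdmissiblePrime W K q} → V3 W K)
        (lam : Finset {ℓ // Zhang2014.IsKolyvaginPrime (W.conductorNorm ℤ) W K 3 ℓ} →
          Finset {q // IsUAdmissiblePrime W K q} → ZMod 3),
      (∀ m : Finset {ℓ // Zhang2014.IsKolyvaginPrime (W.conductorNorm ℤ) W K 3 ℓ},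
        ∃ d : KolyvaginHeegnerData Dt β ι (∏ ℓ ∈ m, (ℓ : ℕ)), κ₀ m ∅ = d.kolyvaginClass Nat.prime_three 1) →
      (∀ (n : Finset {q // IsUAdmissiblePrime W K q}) (q : {q // IsUAdmissiblePrime W K q}),
        GoodLevel W K (insert q n) → Even n.card → q ∉ n →
        ∀ m : Finset {ℓ // Zhang2014.IsKolyvaginPrime (W.conductorNorm ℤ) W K 3 ℓ},
        lam m (insert q n) ≠ 0 → ∃ v : HeightOneSpectrum (𝓞 K), ((q : ℕ) : 𝓞 K) ∈ v.asIdeal ∧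
          κ₀ m n ∉ (W.baseChange K).torsionLocalKer (v.adicCompletion K) ((3 ^ 1 : ℕ) : ℤ)) →
      (∀ n : Finset {q // IsUAdmissiblePrime W K q}, GoodLevel W K n → Odd n.card →
        finrank (ZMod 3) (SelQ W K c n true) + finrank (ZMod 3) (SelQ W K c n false) = 0 → lam ∅ n ≠ 0) →
      finrank (ZMod 3)
        (AddSubgroup.toZModSubmodule 3 (selmerGroup (W.baseChange K) ((3 ^ 1 : ℕ) : ℤ))) = 1 →
      ∃ d : KolyvaginHeegnerData Dt β ι 1, d.kolyvaginClass Nat.prime_three 1 ≠ 0 := by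
  intro W _ _ _ K _ _ Dt β ι hX hmult hsurj hram htam hK hodd hH hLt h3 hβ hc c hc1 _ κ₀ lam realisation lawA anchor h1
  exact kolyvaginClass_one_ne_zero_of_bipartiteFirstFloor W K Dt β ι c hK (algEquiv_mul_self_eq_one K hK c) realisation
    (Method2StubA.stub_levelRaisingAtThree W K Dt β ι hX hmult hsurj hram htam hK hodd hH hLt h3 hβ hc c hc1) lawA anchor h1

end Summit.BirchSwinnertonDyer.Rank1Residual.X11b.Three.Koly.Method2Bipartite

end
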